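import Summits.QuantumFields.QCD.Theorems.ChiralOneScaleTrajectory.Negative.ShellDepth
import Literature.MathematicalPhysics.QuantumFieldTheory.QCDPhaseQuenchedPositivity
import Literature.MathematicalPhysics.QuantumFieldTheory.QCDPhaseQuenchedMomentUpgrade

/-!
# `ChiralOneScaleTrajectory` (crux stmt-QuantumFields-17512) — negative-side support: shell-depth tightness
# across DIFFERENT exponents (Lyapunov transfer)

Companion of `ShellDepth.lean` (standing disprover, cdisprove cycle 1; extract of
`Cruxes/ChiralOneScaleTrajectory/Disproof.lean` §3).  The one-scale exponent of the crux may differ from the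
exponent of clause (iii).  Power means of the phase-quenched PROBABILITY measure are monotone:

* `fm_eq_expect` — the functional `fm` of the clause texts is the tree's `qcdPhaseQuenchedExpect` of `X^s`,
  `X` the colour–spin entry sum of the propagator block;
* `fm_nonneg`, `fm_le_fm_rpow` — `fm(s') ≤ fm(s)^{s'/s}` for `0 < s' ≤ s ≤ 1` (Jensen, `qcdPhaseQuenchedExpect_jensen_all`,
  with the convex `y ↦ y^{s/s'}`; integrability from `integrable_propagatorEntrySum_qcdLatticeMeasure` and
  `X^t ≤ 1 + X`);
* `shellDepth_lower_bound_of_exponent_le` — if (iii) holds at exponent `s₂` and the one-scale matrix at power `q`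
  holds at a larger exponent `s₁ ∈ [s₂, 1]` with `q s₂ ≥ s₁`, then `max C₁ 0 · K₀ > q s₂/s₁ − max p 0` along every
  regularisation with `β_k → +∞`.  So the conclusions of `ShellDepth.lean` (shell budget linear in `q`, `C₁ > 0`,
  log room) persist up to the factor `s₂/s₁` whenever `s_one-scale ≥ s_(iii)`; a witness escapes them formally only
  with `s_one-scale < s_(iii)` — through heavy phase-quenched tails of the propagator modulus on the log-shell (an
  upper bound on a low moment together with a non-small higher moment).
-/

noncomputable section

namespace Summit.QuantumFields.QCD.Theorems.ChiralOneScaleTrajectory.Negative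

open scoped BigOperators Topology
open MeasureTheory Filter Set
open Literature.MathematicalPhysics.QuantumFieldTheory Literature.MathematicalPhysics.QuantumLattice
  Literature.Probability.LatticeModels
open Summit.QuantumFields.QCD.Theorems.MobilityGapNegative

variable {Nf : ℕ}

/-- `fm ≥ 0` (a quotient of integrals of non-negative functions). -/
theorem fm_nonneg (β : ℝ) (mq : Fin Nf → ℝ) (S : ℕ) (f : Fin Nf) (v : Site 4) (s : ℝ) :
    0 ≤ fm Nf β mq S f v s := by
  unfold fm
  refine div_nonneg (integral_nonneg fun U => ?_) (integral_nonneg fun U => norm_nonneg _)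
  exact mul_nonneg (norm_nonneg _) (Real.rpow_nonneg (by positivity) _)

/-- `fm` is the phase-quenched expectation `⟨X^s⟩₊` of the tree (`qcdPhaseQuenchedExpect`), `X` the colour–spin
entry sum of the propagator block. -/
theorem fm_eq_expect (β : ℝ) (mq : Fin Nf → ℝ) (S : ℕ) (f : Fin Nf) (v : Site 4) (s : ℝ) :
    fm Nf β mq S f v s = qcdPhaseQuenchedExpect β (2 * S + 1) mq (fun U =>
      (∑ a : Fin 3, ∑ i : Fin 4, ∑ b : Fin 3, ∑ j : Fin 4,
        ‖(diracMatrix U mq)⁻¹ (quarkEquiv (f, (Torus.proj (2 * S + 1) 0, a, i)))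
          (quarkEquiv (f, (Torus.proj (2 * S + 1) v, b, j)))‖) ^ s) := by
  rw [qcdPhaseQuenchedExpect_eq_div]
  rfl

/-- **Lyapunov transfer between exponents** (power means of the phase-quenched PROBABILITY measure are monotone;
Jensen `qcdPhaseQuenchedExpect_jensen_all` with the convex `y ↦ y^{s/s'}`): for `0 < s' ≤ s ≤ 1`,
`fm(s') ≤ fm(s)^{s'/s}`.  So an UPPER bound at exponent `s` (one-scale) descends to every smaller exponent and a
LOWER bound at exponent `s'` ((iii)) ascends to every larger one. -/
theorem fm_le_fm_rpow (β : ℝ) (mq : Fin Nf → ℝ) (S : ℕ) (f : Fin Nf) (v : Site 4) {s s' : ℝ}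
    (hs' : 0 < s') (hss : s' ≤ s) (hs1 : s ≤ 1) :
    fm Nf β mq S f v s' ≤ (fm Nf β mq S f v s) ^ (s' / s) := by
  have hs : 0 < s := hs'.trans_le hss
  set X : GaugeConfig 4 (2 * S + 1) SU3 → ℝ := fun U =>
    ∑ a : Fin 3, ∑ i : Fin 4, ∑ b : Fin 3, ∑ j : Fin 4,
      ‖(diracMatrix U mq)⁻¹ (quarkEquiv (f, (Torus.proj (2 * S + 1) 0, a, i)))
        (quarkEquiv (f, (Torus.proj (2 * S + 1) v, b, j)))‖ with hXdef
  have hX0 : ∀ U, 0 ≤ X U := fun U => by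
    simp only [hXdef]
    positivity
  have hZ := integral_norm_det_diracMatrix_pos_all (S := 2 * S + 1) β mq
  have hXi : Integrable X (qcdLatticeMeasure (2 * S + 1) β mq) :=
    integrable_propagatorEntrySum_qcdLatticeMeasure β mq hZ f _ _
  haveI := isProbabilityMeasure_qcdLatticeMeasure_all (S := 2 * S + 1) β mq
  have hpow : ∀ {t : ℝ}, 0 ≤ t → t ≤ 1 → Integrable (fun U => X U ^ t) (qcdLatticeMeasure (2 * S + 1) β mq) := by
    intro t ht0 ht1
    refine Integrable.mono' ((integrable_const (1 : ℝ)).add hXi)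
      (hXi.aestronglyMeasurable.aemeasurable.pow_const t).aestronglyMeasurable
      (Eventually.of_forall fun U => ?_)
    rw [Real.norm_eq_abs, abs_of_nonneg (Real.rpow_nonneg (hX0 U) _)]
    show X U ^ t ≤ 1 + X U
    -- `x^t ≤ 1 + x` for `x ≥ 0`, `0 ≤ t ≤ 1`
    rcases le_total (X U) 1 with hle | hle
    · exact (Real.rpow_le_one (hX0 U) hle ht0).trans (by linarith [hX0 U])
    · calc X U ^ t ≤ X U ^ (1 : ℝ) := Real.rpow_le_rpow_of_exponent_le hle ht1
        _ = X U := Real.rpow_one _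
        _ ≤ 1 + X U := by linarith
  have e1 : fm Nf β mq S f v s' = qcdPhaseQuenchedExpect β (2 * S + 1) mq (fun U => X U ^ s') := fm_eq_expect ..
  have e2 : fm Nf β mq S f v s = qcdPhaseQuenchedExpect β (2 * S + 1) mq (fun U => X U ^ s) := fm_eq_expect ..
  have hr : 1 ≤ s / s' := by rw [le_div_iff₀ hs']; linarith
  have hcompf : ((fun y : ℝ => y ^ (s / s')) ∘ fun U => X U ^ s') = fun U => X U ^ s := by
    funext U
    simp only [Function.comp_apply]
    rw [← Real.rpow_mul (hX0 U), mul_div_cancel₀ _ hs'.ne']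
  have hJ := qcdPhaseQuenchedExpect_jensen_all (S := 2 * S + 1) β mq (convexOn_rpow hr)
    (Real.continuous_rpow_const (by positivity)).continuousOn isClosed_Ici (fun U => X U ^ s')
    (Eventually.of_forall fun U => Real.rpow_nonneg (hX0 U) _) (hpow hs'.le (hss.trans hs1))
    (by rw [hcompf]; exact hpow hs.le hs1)
  rw [hcompf] at hJ
  have hA0 : 0 ≤ qcdPhaseQuenchedExpect β (2 * S + 1) mq (fun U => X U ^ s') := by
    rw [qcdPhaseQuenchedExpect_eq_integral_qcdLatticeMeasure]
    exact integral_nonneg fun U => Real.rpow_nonneg (hX0 U) _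
  rw [e1, e2]
  have h1 : qcdPhaseQuenchedExpect β (2 * S + 1) mq (fun U => X U ^ s') =
      ((qcdPhaseQuenchedExpect β (2 * S + 1) mq (fun U => X U ^ s')) ^ (s / s')) ^ (s' / s) := by
    rw [← Real.rpow_mul hA0, div_mul_div_comm, mul_comm s s', div_self (by positivity), Real.rpow_one]
  rw [h1]
  exact Real.rpow_le_rpow (Real.rpow_nonneg hA0 _) hJ (by positivity)

/-- **Shell depth lower bound across exponents.** If (iii) holds at exponent `s₂` and the one-scale matrix at
power `q` holds at a LARGER exponent `s₁ ≥ s₂` (`s₁ ≤ 1`), then — transferring the one-scale bound down to `s₂`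
by `fm_le_fm_rpow`, at the real power `r = q s₂/s₁ ≥ 1` — `max C₁ 0 · K₀ > q s₂/s₁ − max p 0`.  So the
common-exponent conclusions (linear growth of `K₀` in `q`, `C₁ > 0`, log room) persist up to the factor `s₂/s₁`
whenever `s_one-scale ≥ s_(iii)`; only a witness with `s_one-scale < s_(iii)` escapes them formally, and then only
through heavy phase-quenched tails of the propagator modulus on the log-shell (an upper bound on a low moment
with a non-small higher moment). -/
theorem shellDepth_lower_bound_of_exponent_le (reg : QCDRegularisation Nf) (m : Fin Nf → ℝ)
    (hβ : Tendsto reg.β atTop atTop) (f : Fin Nf) {s₁ s₂ c₀ C₁ p K₀ : ℝ} {q : ℕ}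
    (hs₂ : 0 < s₂) (hs₂₁ : s₂ ≤ s₁) (hs₁ : s₁ ≤ 1) (hq : s₁ ≤ q * s₂) (hc₀ : 0 < c₀)
    (hL : ∀ᶠ k in atTop, ∀ S : ℕ, reg.L k ≤ S → ∀ (f : Fin Nf) (n : ℕ), n ≤ S →
      c₀ * Real.exp (-(C₁ * (reg.a k * n) + p * Real.log (n + 1))) ≤
        fm Nf (reg.β k) (bare reg m k) S f (Pi.single 0 (n : ℤ)) s₂)
    (hO : ∀ᶠ k in atTop, ∃ ℓ₀ : ℕ, 1 ≤ ℓ₀ ∧ ℓ₀ ≤ reg.L k ∧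
      (ℓ₀ : ℝ) * reg.a k ≤ K₀ * (1 + |Real.log (reg.a k)|) ∧ ∀ S : ℕ, reg.L k ≤ S →
        ∀ (f : Fin Nf) (v : Site 4), v ∈ box 4 S → ‖v‖ = (ℓ₀ : ℝ) →
          (ℓ₀ : ℝ) ^ q * (1 + |reg.β k|) ^ q * fm Nf (reg.β k) (bare reg m k) S f v s₁ ≤ 1) :
    q * s₂ / s₁ - max p 0 < max C₁ 0 * K₀ := by
  have hs₁0 : 0 < s₁ := hs₂.trans_le hs₂₁
  set t : ℝ := s₂ / s₁ with ht
  have ht0 : 0 < t := div_pos hs₂ hs₁0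
  have hr : (1 : ℝ) ≤ q * s₂ / s₁ := by rw [le_div_iff₀ hs₁0, one_mul]; exact hq
  refine shellDepth_lower_bound_rpow reg m hβ f hr hc₀ hL (hO.mono fun k ⟨ℓ₀, h1, h2, h3, h4⟩ => ?_)
  refine ⟨ℓ₀, h1, h2, h3, fun S hS f v hv hn => ?_⟩
  have hℓ : (1 : ℝ) ≤ ℓ₀ := by exact_mod_cast h1
  have hB : (1 : ℝ) ≤ 1 + |reg.β k| := by linarith [abs_nonneg (reg.β k)]
  set A : ℝ := (ℓ₀ : ℝ) ^ q * (1 + |reg.β k|) ^ q with hA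
  have hA1 : 1 ≤ A := one_le_mul_of_one_le_of_one_le (one_le_pow₀ hℓ) (one_le_pow₀ hB)
  have hA0 : 0 < A := by linarith
  -- `fm(s₁) ≤ 1/A`, hence `fm(s₂) ≤ (1/A)^t = A^{-t}`
  have hf1 : fm Nf (reg.β k) (bare reg m k) S f v s₁ ≤ 1 / A := by
    rw [le_div_iff₀' hA0]; exact h4 S hS f v hv hn
  have hf2 : fm Nf (reg.β k) (bare reg m k) S f v s₂ ≤ A ^ (-t) := by
    calc fm Nf (reg.β k) (bare reg m k) S f v s₂ ≤ (fm Nf (reg.β k) (bare reg m k) S f v s₁) ^ t :=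
          fm_le_fm_rpow _ _ _ _ _ hs₂ hs₂₁ hs₁
      _ ≤ (1 / A) ^ t := Real.rpow_le_rpow (fm_nonneg _ _ _ _ _ _) hf1 ht0.le
      _ = A ^ (-t) := by rw [one_div, Real.inv_rpow hA0.le, Real.rpow_neg hA0.le]
  -- `ℓ₀^r B^r = A^t`
  have hpow : (ℓ₀ : ℝ) ^ (q * s₂ / s₁) * (1 + |reg.β k|) ^ (q * s₂ / s₁) = A ^ t := by
    have e : (q * s₂ / s₁ : ℝ) = (q : ℝ) * t := by rw [ht]; ring
    rw [e, Real.rpow_mul (by linarith), Real.rpow_mul (by linarith), Real.rpow_natCast, Real.rpow_natCast,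
      ← Real.mul_rpow (by positivity) (by positivity)]
  rw [hpow]
  calc A ^ t * fm Nf (reg.β k) (bare reg m k) S f v s₂ ≤ A ^ t * A ^ (-t) :=
        mul_le_mul_of_nonneg_left hf2 (Real.rpow_nonneg hA0.le _)
    _ = 1 := by rw [← Real.rpow_add hA0, add_neg_cancel, Real.rpow_zero]

end Summit.QuantumFields.QCD.Theorems.ChiralOneScaleTrajectory.Negative

end
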